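import Summits.Ventures.DiscreteObjects.Hadamard.ConferenceGraph333Order11RankTest
import Summits.Ventures.DiscreteObjects.Hadamard.ConferenceGraph333Order82

/-!
# Order `22` in Aut(srg(333,166,82,83)): the rank test leaves seven cycle types (kernel)

Framing: lottery ticket; floor = certified bounds/negative ranges.  Cell pub-namedobj (venture DiscreteObjects),
target (H) = `H(668)`, hadamard gen 31.  First census COROLLARY of the kernel rank test (`ConferenceGraph333Order11RankTest`): for `σ` of order
`22` put `ρ = σ²` (order `11`, `#Fix ρ = 25`) and `τ = σ¹¹` (involution); the `τ`-invariant `ρ`-orbits are exactly the orbits of the points of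
`σ`-period `11` (a point `x` moved by `ρ` with `τx ∈ ⟨ρ⟩x` has `τx = x`), so `t = (#Fix σ¹¹ − #Fix σ)/11`, `f_F = #Fix σ`, and `(t − f_F)² ≤ 9`.
With the cycle-length census kit (`c₁ ∈ {1,5,9,13}`, `c₁₁ ∈ {0,44,88,132}`: sixteen types) this leaves
* **`aut_order22_census`** — `#Fix σ² = 25` and `(#Fix σ, #Fix σ¹¹) ∈ {(1,1), (1,45), (5,49), (5,93), (9,97), (9,141), (13,145)}` — seven of the sixteen
  kit-admissible pairs (E2: pub-namedobj-hadamard-g31/results/rank_test_11_g31.txt, the KEEP rows for `n = 22`).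
WORDS: structure of a HYPOTHETICAL object (order `22` remains admissible); ours (PROVISIONAL).  No `sorry`, no new definitions.
-/

namespace Summit.Ventures.DiscreteObjects.Hadamard

open Finset

section order22
variable {V : Type*} [Fintype V] [DecidableEq V]

/-- **Order `22`: seven admissible (`#Fix σ`, `#Fix σ¹¹`) pairs.** -/
theorem aut_order22_census (hV : Fintype.card V = 333) (A : Matrix V V ℤ)
    (h01 : ∀ x y, A x y = 0 ∨ A x y = 1) (hsymm : ∀ x y, A y x = A x y) (hdiag : ∀ x, A x x = 0)
    (hk : ∀ x, ∑ y, A x y = 166) (hsrg : ∀ x y, ∑ z, A x z * A z y = 83 * (1 + (if x = y then 1 else 0)) - A x y)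
    (σ : Equiv.Perm V) (hσ : σ ^ 22 = 1) (hσ11 : σ ^ 11 ≠ 1) (hσ2 : σ ^ 2 ≠ 1) (hA : ∀ x y, A (σ x) (σ y) = A x y) :
    (univ.filter fun x => (σ ^ 2) x = x).card = 25 ∧
    (((univ.filter fun x => σ x = x).card = 1 ∧ (univ.filter fun x => (σ ^ 11) x = x).card = 1) ∨
     ((univ.filter fun x => σ x = x).card = 1 ∧ (univ.filter fun x => (σ ^ 11) x = x).card = 45) ∨
     ((univ.filter fun x => σ x = x).card = 5 ∧ (univ.filter fun x => (σ ^ 11) x = x).card = 49) ∨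
     ((univ.filter fun x => σ x = x).card = 5 ∧ (univ.filter fun x => (σ ^ 11) x = x).card = 93) ∨
     ((univ.filter fun x => σ x = x).card = 9 ∧ (univ.filter fun x => (σ ^ 11) x = x).card = 97) ∨
     ((univ.filter fun x => σ x = x).card = 9 ∧ (univ.filter fun x => (σ ^ 11) x = x).card = 141) ∨
     ((univ.filter fun x => σ x = x).card = 13 ∧ (univ.filter fun x => (σ ^ 11) x = x).card = 145)) := by
  have hAk := adj_pow_invariant A σ hA
  -- ρ = σ², τ = σ¹¹
  have hρ : (σ ^ 2) ^ 11 = 1 := by rw [← pow_mul]; exact hσ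
  have hτ2 : ∀ x, (σ ^ 11) ((σ ^ 11) x) = x := fun x => by
    have := congrArg (fun g : Equiv.Perm V => g x) (show (σ ^ 11) ^ 2 = 1 by rw [← pow_mul]; exact hσ)
    simpa [pow_two] using this
  have hcomm : σ ^ 11 * σ ^ 2 = σ ^ 2 * σ ^ 11 := by rw [← pow_add, ← pow_add]
  have hcommk : ∀ (k : ℕ) x, (σ ^ 11) (((σ ^ 2) ^ k) x) = ((σ ^ 2) ^ k) ((σ ^ 11) x) := fun k x => by
    rw [← Equiv.Perm.mul_apply, ← Equiv.Perm.mul_apply, ← pow_mul, ← pow_add, ← pow_add, add_comm]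
  -- the rank test
  obtain ⟨t, ht11, hineq⟩ := aut_order11_commuting_rank_test hV A h01 hsymm hdiag hk hsrg (σ ^ 2) hρ hσ2 (hAk 2) (σ ^ 11) hcomm (hAk 11)
  -- Fix τ ∩ Fix ρ = Fix σ
  have hfix : (univ.filter fun x => (σ ^ 11) x = x ∧ (σ ^ 2) x = x) = univ.filter fun x => σ x = x := by
    refine Finset.filter_congr fun x _ => ⟨fun ⟨h11, h2⟩ => ?_, fun h => ⟨?_, ?_⟩⟩
    · have h12 : (σ ^ 12) x = x := by
        rw [show (12 : ℕ) = 2 * 6 by norm_num, pow_mul]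
        exact Equiv.Perm.pow_apply_eq_self_of_apply_eq_self h2 6
      rw [pow_succ', Equiv.Perm.mul_apply, h11] at h12
      exact h12
    · exact Equiv.Perm.pow_apply_eq_self_of_apply_eq_self h 11
    · exact Equiv.Perm.pow_apply_eq_self_of_apply_eq_self h 2
  rw [hfix] at hineq
  -- a ρ-moved point x with τx in its ρ-orbit is τ-fixed
  have hkey : ∀ x, (σ ^ 2) x ≠ x →
      ((σ ^ 11) x ∈ (Finset.range 11).image (fun k => ((σ ^ 2) ^ k) x) ↔ (σ ^ 11) x = x) := by
    intro x hx
    constructor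
    · intro hmem
      obtain ⟨k, hk11, hkx⟩ := Finset.mem_image.mp hmem
      rw [Finset.mem_range] at hk11
      -- x = τ(τ x) = τ(ρ^k x) = ρ^k (τ x) = ρ^(2k) x
      have h2k : ((σ ^ 2) ^ (2 * k)) x = x := by
        have e := hτ2 x
        rw [← hkx, hcommk, ← hkx, ← Equiv.Perm.mul_apply, ← pow_add, ← two_mul] at e
        exact e
      by_cases hk0 : k = 0
      · rw [← hkx, hk0, pow_zero, Equiv.Perm.one_apply]
      · exfalso
        rw [perm_pow_apply_mod (σ ^ 2) hρ] at h2k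
        have hne : (2 * k) % 11 ≠ 0 := by omega
        exact hx (perm_fixed_of_pow_fixed (σ ^ 2) (by norm_num) hρ (Nat.pos_of_ne_zero hne) (Nat.mod_lt _ (by norm_num)) x h2k)
    · intro h
      rw [h]
      exact Finset.mem_image.mpr ⟨0, Finset.mem_range.mpr (by norm_num), by simp⟩
  have hset : (univ.filter fun x => (σ ^ 2) x ≠ x ∧ (σ ^ 11) x ∈ (Finset.range 11).image (fun k => ((σ ^ 2) ^ k) x)) =
      univ.filter fun x => (σ ^ 11) x = x ∧ ¬ (σ ^ 2) x = x := by
    refine Finset.filter_congr fun x _ => ⟨fun ⟨hx, hm⟩ => ⟨(hkey x hx).mp hm, hx⟩, fun ⟨h, hx⟩ => ⟨hx, (hkey x hx).mpr h⟩⟩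
  have hX : (univ.filter fun x => (σ ^ 11) x = x ∧ ¬ (σ ^ 2) x = x).card = 11 * t := by rw [← hset]; exact ht11
  -- #Fix τ = #(Fix τ ∩ Fix ρ) + #(Fix τ ∖ Fix ρ)
  have hsplit := Finset.card_filter_add_card_filter_not (s := univ.filter fun x => (σ ^ 11) x = x) (fun x => (σ ^ 2) x = x)
  rw [Finset.filter_filter, Finset.filter_filter, hfix, hX] at hsplit
  -- the census kit for order 22
  obtain ⟨c, h1, h2, -, h4, h6⟩ := aut_cycle_length_census hV A h01 hsymm hdiag hk hsrg σ hσ (by norm_num) hA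
  have hD : Nat.divisors 22 = {1, 2, 11, 22} := by decide
  have f1 := h2 1
  have f2 := h2 2
  have f11 := h2 11
  have e2 := h6 2 (by norm_num)
  have e11 := h6 11 (by norm_num)
  have e22 := h6 22 (by norm_num)
  have o22 := h4 22 (by norm_num)
  rw [pow_one] at f1
  simp only [hD, Finset.sum_filter] at h1 f1 f2 f11
  norm_num at h1 f1 f2 f11
  rw [f1] at o22
  have w2 := aut_order11_fixed hV A h01 hsymm hdiag hk hsrg (σ ^ 2) hρ hσ2 (hAk 2)
  rw [f2] at w2
  obtain ⟨wm11, wl11⟩ := involution_window_149 hV A h01 hsymm hdiag hk hsrg (σ ^ 11) hτ2 hσ11 (hAk 11)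
  rw [f11] at wm11 wl11
  rw [f1, f11] at hsplit
  rw [f1] at hineq
  obtain ⟨hlo, hhi⟩ := abs_le_of_sq_le_sq' (show ((t : ℤ) - ((c 1 : ℕ) : ℤ)) ^ 2 ≤ (3 : ℤ) ^ 2 by norm_num; exact hineq)
    (by norm_num)
  rw [f1, f2, f11]
  clear hAk h2 h4 h6 hD hA hsrg hk hdiag hsymm h01 hσ hρ hτ2 hcomm hcommk hfix hkey hset hineq ht11 hX f1 f2 f11
  refine ⟨w2, ?_⟩
  -- c 1 ∈ {1,5,9,13}, c 11 = 11 t ∈ {0,44,88,132}, |t - c 1| ≤ 3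
  have hc1 : c 1 = 1 ∨ c 1 = 5 ∨ c 1 = 9 ∨ c 1 = 13 := by rcases o22 with o | o <;> omega
  have hc11 : c 11 = 11 * t := by omega
  have ht : t = 0 ∨ t = 4 ∨ t = 8 ∨ t = 12 := by omega
  have key : (c 1 = 1 ∧ t = 0) ∨ (c 1 = 1 ∧ t = 4) ∨ (c 1 = 5 ∧ t = 4) ∨ (c 1 = 5 ∧ t = 8) ∨ (c 1 = 9 ∧ t = 8) ∨
      (c 1 = 9 ∧ t = 12) ∨ (c 1 = 13 ∧ t = 12) := by
    rcases hc1 with h | h | h | h <;> rcases ht with h' | h' | h' | h' <;> rw [h, h'] at hlo hhi ⊢ <;> omega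
  clear hlo hhi hc1 ht wm11 wl11 w2 hsplit h1 e2 e11 e22 o22
  rw [hc11]
  rcases key with ⟨h, h'⟩ | ⟨h, h'⟩ | ⟨h, h'⟩ | ⟨h, h'⟩ | ⟨h, h'⟩ | ⟨h, h'⟩ | ⟨h, h'⟩ <;> rw [h, h'] <;> norm_num

end order22

end Summit.Ventures.DiscreteObjects.Hadamard
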